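import Mathlib.Data.ENat.Basic
import Mathlib.ModelTheory.Definability
import Mathlib.MeasureTheory.Measure.Lebesgue.Basic
import Literature.NumberTheory.Transcendental.KZCalculusOver
import Literature.NumberTheory.Transcendental.SemialgebraicMapsProofs
import Literature.ModelTheory.ExponentialFields.DecidableTheory
import Literature.ModelTheory.ExponentialFields.RealClosedFieldTheoryProofs
import HarnessLib

/-!
# Tame one-sided certificates in the Kontsevich–Zagier calculus and the inequality cost

Topic `NumberTheory/Transcendental`, an addendum to `KZCalculus.lean` (the calculus of moves on
`ℚ`-semialgebraic integral representations, [Kontsevich–Zagier 2001, §1.2]) and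
`KZCalculusOver.lean` (the same calculus over a coefficient ring `k ⊆ ℝ`, and its *raw encoding*
`KZOver.Raw`: the free abelian group on ALL pairs `(σ ⊆ ℝᵏ, f : ℝᵏ → ℝ)` with admissibility as a
side condition of the moves).

Viu-Sos [Viusos2020, §4, Lemmas 4.1–4.3 and Remark 4.1] proves a STRICT inequality
`vol K₂ < vol K₁` between volumes of compact semialgebraic sets *inside the KZ-rules*: a rational
cube mesh, one piecewise-translation change of variables packing the outer cubes of `K₂` into the
inner cubes of `K₁`, and additivity; the chain has bounded length but its description grows with
the mesh. This file fixes the bookkeeping that makes "the size of such an inequality proof" a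
number (definition request D2 of route `KontsevichZagierPeriods/InequalityCost`, whose item
`BoundedCost` carried the calculus below inline as a `let`-prefix; the definitions here are that
prefix, verbatim, turned into named declarations):

* `KZ.RawPair`, `KZ.RawFormal`, `KZ.rawGen`, `KZ.rawEval` — raw real pairs `(σ ⊆ ℝᵏ, f)`, their
  free abelian group (the SAME type as in `KZOver.Raw`), generators, and evaluation `∫_σ f`;
* `KZ.TameCplx N k S` — DESCRIPTION COMPLEXITY `≤ N`: `S = {x | φ(x, θ)}` for a parameter-free
  formula `φ` of the language of ordered rings with Gödel number `Encodable.encode φ ≤ N`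
  (the tree's computable coding, `DecidableTheory.lean`) and `≤ N` real parameters `θ`;
* `KZ.TameAdm N x` — `N`-TAMENESS of a raw pair: dimension `≤ N`, domain in the box `[−N, N]ᵏ`,
  `|f| ≤ N` on the domain, `f = 0` off the domain, complexity `≤ N` of the domain and of the graph;
* `KZ.tameDomainAddMoves N`, `tameIntegrandAddMoves N`, `tameCovMoves N`, `tameNLMoves N`,
  `tameMoves N` — the four KZ moves rewritten over raw real data with `TameAdm N` / `TameCplx N` on
  every datum (and `|F| ≤ N` for primitives);
* `KZ.TameCert N c ε` — a ONE-SIDED `ε`-CERTIFICATE OF SIZE `≤ N` for a formal combination `c`: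
  `c + [([0, ε] ⊆ ℝ¹, 1)] − [p] = Σ_{i < N} mᵢ` with `p` an `N`-tame pair with integrand `≥ 0` and
  each `mᵢ ∈ ±tameMoves N ∪ {0}`; for two volume forms `c = volGen n σA − volGen n σB` this is the
  `Cert N n σA σB ε` of item `BoundedCost`;
* `KZ.inequalityCost c ε : ℕ∞` — the least such `N` (`⊤` if none).

## Main statements (all proved)

* `TameCplx.isSemialgebraic` / `.measurableSet`: sets of bounded complexity are real semialgebraic
  (Tarski–Seidenberg, via `isSemialgebraic_of_definable` and base change), hence Borel;
* `TameAdm.measurable`, `TameAdm.integrable`, `TameAdm.rawAdm`: tame pairs are bounded Borel with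
  bounded support, hence absolutely integrable, hence admissible in `KZOver.Raw`;
* `tameMoves_subset_rawRel`: every tame move is a raw real KZ move, so (`rawEval_eq_zero_of_mem_rawRel`,
  soundness of `KZ_ℝ` from `KZCalculusOver`) evaluates to `0`;
* **soundness** `TameCert.neg_le_rawEval`: a certificate at `ε ≥ 0` proves `rawEval c ≥ −ε`; for
  volume forms `TameCert.neg_le_measureReal_sub` / `TameCert.neg_le_value_sub`
  (`vol σA − vol σB ≥ −ε`);
* monotonicity in the size `TameCert.mono`, and the cost API `inequalityCost_le_iff`,
  `inequalityCost_eq_top_iff`, `inequalityCost_lt_top_iff`;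
* non-vacuity `exists_forall_tameCert_zero` / `exists_forall_inequalityCost_sub_self_le`: the
  trivial identity `c − c` has certificates of ONE size for all `ε ∈ [0, 1]` (two explicit formula
  templates for the padding pair `([0, ε], 1)`);
* `TameCert.of_sub_eq_sum` (tame chains extend certificates) and
  `exists_forall_tameCert_of_mem_closure` / `exists_forall_inequalityCost_le_of_mem_closure`:
  a combination in the subgroup generated by `tameMoves N` (tame-equivalent volume forms) has cost
  bounded uniformly over `ε ∈ [0, 1]`.

## References

* M. Kontsevich, D. Zagier, *Periods*, in: Mathematics Unlimited — 2001 and Beyond, Springer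
  (2001), §1.2 (the three rules; Problem 2 on the "simplicity" of representations).
* J. Viu-Sos, *A semi-canonical reduction for periods of Kontsevich–Zagier*, Int. J. Number Theory
  17 (2021) = arXiv:1509.01097, §4 (Lemmas 4.1–4.3, Remark 4.1: the difference-set / packing
  construction "respects the KZ-rules").
* H. B. Enderton, *A Mathematical Introduction to Logic*, §3.4 (Gödel numbering) — the coding is
  the tree's `FirstOrder.Language.Formula.instEncodable`.

## Design notes

* The certificate calculus is the route's POSITED object (what is cited is KZ's list of rules and
  Viu-Sos' packing certificates); nothing here is claimed to be in print beyond that.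
* `TameCert` is stated for an arbitrary formal combination `c : RawFormal` (route text D2:
  "`KZ.TameCert N c ε`", soundness "`eval c ≥ −ε`"); the two-volume-form instance of item
  `BoundedCost` is `TameCert N (volGen n σA - volGen n σB) ε`, and unfolding the definitions gives
  back the item's `let`-prefix literally (checked: `example : BoundedCost ↔ ∀ ⦃n⦄ N₀ A B, … →
  ∃ N, ∀ ε : ℚ, 0 < ε → ε < 1 → KZ.TameCert N (KZ.volGen n A.domain - KZ.volGen n B.domain) ε :=
  Iff.rfl` elaborates against the route file).
* `TameAdm` takes a sigma-pair `x : RawPair` and uses the projections `x.1`, `x.2.1`, `x.2.2`, as the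
  inline text does; the API lemmas are stated for `x = ⟨k, σ, f⟩`.
* `inequalityCost` is `Nat.find` under `Classical` (like `KZ.degree` in `KZDegree.lean`), valued in
  `ℕ∞` with `⊤` for "no certificate of any size".
* NOT here (theorems for the route, not definitions): monotonicity in `ε` by padding with a box,
  certificates from `ℚ`-chains of tame representations, `ℝ → ℚ̄` transfer of parameters at rational
  `ε`, finiteness of the cost (item FinitePacking), first-order definability of the level sets
  `{ε | TameCert N c ε}`.
-/

noncomputable section

open MeasureTheory Set
open scoped BigOperators
open Literature.ModelTheory.ExponentialFields (IsSemialgebraic Language.orderedRing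
  tarski_seidenberg_real_holds isSemialgebraic_of_definable)

namespace Literature.NumberTheory.Transcendental

namespace KZ

/-! ### Raw real pairs, their formal group and evaluation -/

/-- A *raw real pair* `⟨k, σ, f⟩`: a dimension `k`, a subset `σ ⊆ ℝᵏ` and a function `f : ℝᵏ → ℝ`,
with no semialgebraicity or integrability asked (the generators of the raw encoding
`KZOver.Raw` of the real-coefficient KZ calculus). [cite: KontsevichZagier2001, §1.2] -/
abbrev RawPair : Type := Σ k : ℕ, Set (Fin k → ℝ) × ((Fin k → ℝ) → ℝ)

/-- The free abelian group on raw real pairs: formal `ℤ`-combinations of integrals `∫_σ f` with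
arbitrary real data (the ambient group of `KZOver.Raw.Rel`). [cite: KontsevichZagier2001, §1.2] -/
abbrev RawFormal : Type := FreeAbelianGroup RawPair

/-- The generator `[(σ, f)]` of `RawFormal` in dimension `k`; definitionally `KZOver.Raw.gen k σ f`
(`rawGen_eq_gen`). [cite: KontsevichZagier2001, §1.2] -/
def rawGen (k : ℕ) (σ : Set (Fin k → ℝ)) (f : (Fin k → ℝ) → ℝ) : RawFormal :=
  FreeAbelianGroup.of ⟨k, σ, f⟩

/-- `rawGen` is the raw generator `KZOver.Raw.gen` of `KZCalculusOver` (by `rfl`).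
[cite: KontsevichZagier2001, §1.2] -/
theorem rawGen_eq_gen (k : ℕ) (σ : Set (Fin k → ℝ)) (f : (Fin k → ℝ) → ℝ) :
    rawGen k σ f = KZOver.Raw.gen k σ f := rfl

/-- Evaluation of formal combinations of raw pairs: the additive extension of
`(σ, f) ↦ ∫ x in σ, f x` (Lebesgue measure; Bochner integral, so `0` for non-integrable data).
[cite: KontsevichZagier2001, §1.2] -/
def rawEval : RawFormal →+ ℝ := FreeAbelianGroup.lift fun x => ∫ z in x.2.1, x.2.2 z

/-- `rawEval` of a generator is the integral. [cite: KontsevichZagier2001, §1.2] -/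
@[simp] theorem rawEval_rawGen (k : ℕ) (σ : Set (Fin k → ℝ)) (f : (Fin k → ℝ) → ℝ) :
    rawEval (rawGen k σ f) = ∫ z in σ, f z :=
  FreeAbelianGroup.lift_apply_of _ _

/-- `rawEval` extends the evaluation `KZOver.eval ℝ` of the real-coefficient calculus along the
raw encoding `KZOver.toRaw`. [cite: KontsevichZagier2001, §1.2] -/
theorem rawEval_comp_toRaw : rawEval.comp KZOver.toRaw = KZOver.eval ℝ :=
  FreeAbelianGroup.lift_ext _ _ fun ⟨n, r⟩ => by
    change rawEval (KZOver.toRaw (KZOver.of r)) = KZOver.eval ℝ (KZOver.of r)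
    rw [KZOver.toRaw_of, KZOver.eval_of, ← rawGen_eq_gen, rawEval_rawGen]
    rfl

/-- `rawEval (toRaw c) = eval ℝ c`. [cite: KontsevichZagier2001, §1.2] -/
@[simp] theorem rawEval_toRaw (c : KZOver.FormalRep ℝ) :
    rawEval (KZOver.toRaw c) = KZOver.eval ℝ c :=
  DFunLike.congr_fun rawEval_comp_toRaw c

/-- **Soundness of the raw real calculus**: every element of `KZOver.Raw.Rel` (the subgroup
generated by the four real-coefficient moves with admissible entries) evaluates to `0` — it is
`toRaw` of a relation of `KZ_ℝ`, which lies in the kernel of `eval ℝ`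
(`KZOver.eval_eq_zero_of_mem_relations`). [cite: KontsevichZagier2001, §1.2] -/
theorem rawEval_eq_zero_of_mem_rawRel {c : RawFormal} (hc : c ∈ KZOver.Raw.Rel) : rawEval c = 0 := by
  rw [← KZOver.map_toRaw_relations] at hc
  obtain ⟨c', hc', rfl⟩ := hc
  rw [rawEval_toRaw]
  exact KZOver.eval_eq_zero_of_mem_relations hc'

/-- The *volume-form generator* of a set `σ ⊆ ℝⁿ`: the raw pair `(σ, 1_σ)` (integrand the
indicator of `σ`, so that it vanishes off the domain as tameness demands).
[cite: Viusos2020, §4] -/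
def volGen (n : ℕ) (σ : Set (Fin n → ℝ)) : RawFormal := rawGen n σ (σ.indicator fun _ => (1 : ℝ))

/-- The `ε`-interval `[0, ε] ⊆ ℝ¹` (empty for `ε < 0`), the padding term of one-sided
certificates. [cite: Viusos2020, §4] -/
def epsInterval (ε : ℝ) : Set (Fin 1 → ℝ) := {x : Fin 1 → ℝ | 0 ≤ x 0 ∧ x 0 ≤ ε}

/-- Membership in `epsInterval ε` (by `rfl`). [cite: Viusos2020, §4] -/
@[simp] theorem mem_epsInterval {ε : ℝ} {x : Fin 1 → ℝ} : x ∈ epsInterval ε ↔ 0 ≤ x 0 ∧ x 0 ≤ ε :=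
  Iff.rfl

/-- `epsInterval ε` is the order interval `Icc 0 (fun _ => ε)` of `Fin 1 → ℝ`. [cite: Viusos2020, §4] -/
theorem epsInterval_eq_Icc (ε : ℝ) : epsInterval ε = Icc (0 : Fin 1 → ℝ) (fun _ => ε) := by
  ext x
  simp only [mem_epsInterval, mem_Icc, Pi.le_def, Pi.zero_apply, Fin.forall_fin_one]

/-- `epsInterval ε` is measurable. [cite: Viusos2020, §4] -/
theorem measurableSet_epsInterval (ε : ℝ) : MeasurableSet (epsInterval ε) := by
  rw [epsInterval_eq_Icc]; exact measurableSet_Icc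

/-- The length of `[0, ε]` is `ENNReal.ofReal ε` (so `ε` for `ε ≥ 0`, and `0` otherwise).
[cite: Viusos2020, §4] -/
theorem volume_epsInterval (ε : ℝ) : volume (epsInterval ε) = ENNReal.ofReal ε := by
  rw [epsInterval_eq_Icc, Real.volume_Icc_pi]
  simp

/-- `rawEval` of a volume-form generator of a measurable set is its (real) volume.
[cite: Viusos2020, §4] -/
theorem rawEval_volGen {n : ℕ} {σ : Set (Fin n → ℝ)} (hσ : MeasurableSet σ) :
    rawEval (volGen n σ) = volume.real σ := by
  simp only [volGen, rawEval_rawGen]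
  rw [setIntegral_congr_fun hσ (fun x hx => Set.indicator_of_mem hx _), setIntegral_const,
    smul_eq_mul, mul_one]

/-- `rawEval [([0, ε], 1)] = ε` for `ε ≥ 0`. [cite: Viusos2020, §4] -/
theorem rawEval_volGen_epsInterval {ε : ℝ} (hε : 0 ≤ ε) : rawEval (volGen 1 (epsInterval ε)) = ε := by
  rw [rawEval_volGen (measurableSet_epsInterval ε), measureReal_def, volume_epsInterval,
    ENNReal.toReal_ofReal hε]

/-! ### Description complexity -/

/-- **Description complexity `≤ N`** of a set `S ⊆ ℝᵏ`: `S = {x | φ(x, θ)}` for a PARAMETER-FREE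
first-order formula `φ` of the language of ordered rings `(+, *, -, 0, 1, ≤)` in `k + q` variables
whose Gödel number (the tree's computable coding `Formula.instEncodable`) is `≤ N`, and a tuple of
`q ≤ N` REAL parameters `θ`. By Tarski–Seidenberg such an `S` is real semialgebraic
(`TameCplx.isSemialgebraic`); for fixed `N` only finitely many templates `φ` occur. Verbatim the
`let Cplx` of item `BoundedCost` (route InequalityCost). [folklore] -/
def TameCplx (N k : ℕ) (S : Set (Fin k → ℝ)) : Prop :=
  ∃ (q : ℕ) (φ : Language.orderedRing.Formula (Fin (k + q))) (θ : Fin q → ℝ),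
    q ≤ N ∧ Encodable.encode φ ≤ N ∧ S = {x | φ.Realize (Fin.append x θ)}

namespace TameCplx

variable {N N' k : ℕ} {S : Set (Fin k → ℝ)}

/-- Complexity bounds are monotone in the bound. [folklore] -/
theorem mono (h : TameCplx N k S) (hN : N ≤ N') : TameCplx N' k S := by
  obtain ⟨q, φ, θ, hq, hφ, hS⟩ := h
  exact ⟨q, φ, θ, hq.trans hN, hφ.trans hN, hS⟩

/-- **Sets of bounded complexity are real semialgebraic** (Tarski–Seidenberg): the parameter-free
realization set `{z ∈ ℝᵏ⁺ᵠ | φ(z)}` is `∅`-definable, hence `ℚ`-semialgebraic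
(`isSemialgebraic_of_definable`, [BasuPollackRoy2006, Cor. 2.78]), hence `ℝ`-semialgebraic
(`IsSemialgebraic.baseChange`), and `S` is its preimage under the polynomial map `x ↦ (x, θ)`
(`IsSemialgebraic.preimage_aeval`). [cite: BasuPollackRoy2006, Cor. 2.78 (§2.5.1)] -/
theorem isSemialgebraic (h : TameCplx N k S) : IsSemialgebraic ℝ S := by
  obtain ⟨q, φ, θ, -, -, rfl⟩ := h
  have h0 : IsSemialgebraic ℚ {z : Fin (k + q) → ℝ | φ.Realize z} :=
    isSemialgebraic_of_definable
      ((Set.empty_definable_iff.mpr ⟨φ, rfl⟩).mono (Set.empty_subset _))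
  have h1 : IsSemialgebraic ℝ {z : Fin (k + q) → ℝ | φ.Realize z} := h0.baseChange ℝ
  convert h1.preimage_aeval
    (Fin.append (fun i : Fin k => (MvPolynomial.X i : MvPolynomial (Fin k) ℝ))
      (fun j : Fin q => MvPolynomial.C (θ j))) using 1
  ext x
  simp only [mem_setOf_eq, mem_preimage]
  refine iff_of_eq (congrArg _ (funext fun i => ?_))
  induction i using Fin.addCases with
  | left i => simp
  | right j => simp

/-- Sets of bounded complexity are Borel measurable. [cite: BochnakCosteRoy1998, §2.1] -/
theorem measurableSet (h : TameCplx N k S) : MeasurableSet S :=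
  IsSemialgebraic.measurableSet_holds h.isSemialgebraic

end TameCplx

/-! ### Tameness of raw pairs -/

/-- **`N`-tameness** (admissibility at level `N`) of a raw pair `x = ⟨k, σ, f⟩`: dimension
`k ≤ N`; every `z ∈ σ` lies in the box `[−N, N]ᵏ` and has `|f z| ≤ N`; `f` vanishes off `σ`;
and both `σ ⊆ ℝᵏ` and the graph `{(z, f z) | z ∈ σ} ⊆ ℝᵏ⁺¹` have description complexity `≤ N`.
Tame pairs are bounded Borel data (`TameAdm.integrable`), so no integrability side condition is
needed. Verbatim the `let Adm` of item `BoundedCost` (route InequalityCost), written on the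
projections `x.1`, `x.2.1`, `x.2.2` as there. [cite: KontsevichZagier2001, §1.2] -/
def TameAdm (N : ℕ) (x : RawPair) : Prop :=
  x.1 ≤ N ∧ (∀ z ∈ x.2.1, (∀ i, |z i| ≤ N) ∧ |x.2.2 z| ≤ N) ∧ (∀ z ∉ x.2.1, x.2.2 z = 0) ∧
    TameCplx N x.1 x.2.1 ∧
    TameCplx N (x.1 + 1) {w : Fin (x.1 + 1) → ℝ | Fin.init w ∈ x.2.1 ∧ w (Fin.last x.1) = x.2.2 (Fin.init w)}

namespace TameAdm

variable {N N' k : ℕ} {σ : Set (Fin k → ℝ)} {f : (Fin k → ℝ) → ℝ}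

/-- Tameness is monotone in the level. [cite: KontsevichZagier2001, §1.2] -/
theorem mono {x : RawPair} (h : TameAdm N x) (hN : N ≤ N') : TameAdm N' x := by
  obtain ⟨hk, hbd, hzero, hc, hcg⟩ := h
  have hNR : (N : ℝ) ≤ N' := Nat.cast_le.mpr hN
  exact ⟨hk.trans hN, fun z hz => ⟨fun i => ((hbd z hz).1 i).trans hNR, (hbd z hz).2.trans hNR⟩,
    hzero, hc.mono hN, hcg.mono hN⟩

/-- The dimension of a tame pair is at most the level. [cite: KontsevichZagier2001, §1.2] -/
theorem dim_le (h : TameAdm N ⟨k, σ, f⟩) : k ≤ N := h.1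

/-- The domain of a tame pair lies in the box `[−N, N]ᵏ`. [cite: KontsevichZagier2001, §1.2] -/
theorem abs_le (h : TameAdm N ⟨k, σ, f⟩) {z : Fin k → ℝ} (hz : z ∈ σ) (i : Fin k) : |z i| ≤ N :=
  (h.2.1 z hz).1 i

/-- The integrand of a tame pair is bounded by `N` on the domain. [cite: KontsevichZagier2001, §1.2] -/
theorem abs_apply_le (h : TameAdm N ⟨k, σ, f⟩) {z : Fin k → ℝ} (hz : z ∈ σ) : |f z| ≤ N :=
  (h.2.1 z hz).2

/-- The integrand of a tame pair vanishes off the domain. [cite: KontsevichZagier2001, §1.2] -/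
theorem apply_eq_zero (h : TameAdm N ⟨k, σ, f⟩) {z : Fin k → ℝ} (hz : z ∉ σ) : f z = 0 :=
  h.2.2.1 z hz

/-- The domain of a tame pair has complexity `≤ N`. [cite: KontsevichZagier2001, §1.2] -/
theorem tameCplx (h : TameAdm N ⟨k, σ, f⟩) : TameCplx N k σ := h.2.2.2.1

/-- The graph of a tame pair has complexity `≤ N`. [cite: KontsevichZagier2001, §1.2] -/
theorem tameCplx_graph (h : TameAdm N ⟨k, σ, f⟩) :
    TameCplx N (k + 1) {w : Fin (k + 1) → ℝ | Fin.init w ∈ σ ∧ w (Fin.last k) = f (Fin.init w)} :=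
  h.2.2.2.2

/-- The integrand of a tame pair is bounded by `N` everywhere. [cite: KontsevichZagier2001, §1.2] -/
theorem abs_apply_le' (h : TameAdm N ⟨k, σ, f⟩) (z : Fin k → ℝ) : |f z| ≤ N := by
  by_cases hz : z ∈ σ
  · exact h.abs_apply_le hz
  · rw [h.apply_eq_zero hz, abs_zero]; positivity

/-- The domain of a tame pair is real semialgebraic. [cite: BochnakCosteRoy1998, §2.1] -/
theorem isSemialgebraic (h : TameAdm N ⟨k, σ, f⟩) : IsSemialgebraic ℝ σ := h.tameCplx.isSemialgebraic

/-- The domain of a tame pair is measurable. [cite: BochnakCosteRoy1998, §2.1] -/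
theorem measurableSet (h : TameAdm N ⟨k, σ, f⟩) : MeasurableSet σ := h.tameCplx.measurableSet

/-- The integrand of a tame pair is a real semialgebraic function on the domain (its graph has
bounded complexity). [cite: BochnakCosteRoy1998, Def. 2.2.5] -/
theorem isSemialgebraicFunOn (h : TameAdm N ⟨k, σ, f⟩) : IsSemialgebraicFunOn ℝ σ f :=
  isSemialgebraicFunOn_iff.mpr h.tameCplx_graph.isSemialgebraic

/-- The integrand of a tame pair is its own extension by zero off the domain.
[cite: KontsevichZagier2001, §1.2] -/
theorem indicator_eq (h : TameAdm N ⟨k, σ, f⟩) : σ.indicator f = f :=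
  Set.indicator_eq_self.mpr fun _ hz => by_contra fun hzσ => hz (h.apply_eq_zero hzσ)

/-- **Tame integrands are Borel** (semialgebraic functions are measurable,
`IsSemialgebraicFunOn.measurable_indicator_of_tarskiSeidenberg`). [cite: BochnakCosteRoy1998, §2.2] -/
theorem measurable (h : TameAdm N ⟨k, σ, f⟩) : Measurable f := by
  rw [← h.indicator_eq]
  exact h.isSemialgebraicFunOn.measurable_indicator_of_tarskiSeidenberg
    tarski_seidenberg_real_holds h.measurableSet

/-- The domain of a tame pair lies in the closed sup-norm ball of radius `N`.
[cite: KontsevichZagier2001, §1.2] -/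
theorem subset_closedBall (h : TameAdm N ⟨k, σ, f⟩) : σ ⊆ Metric.closedBall 0 N := fun z hz => by
  rw [mem_closedBall_zero_iff, pi_norm_le_iff_of_nonneg (Nat.cast_nonneg N)]
  intro i
  rw [Real.norm_eq_abs]
  exact h.abs_le hz i

/-- The domain of a tame pair has finite volume. [cite: KontsevichZagier2001, §1.2] -/
theorem volume_lt_top (h : TameAdm N ⟨k, σ, f⟩) : volume σ < ⊤ :=
  (measure_mono h.subset_closedBall).trans_lt measure_closedBall_lt_top

/-- **Tame pairs are absolutely integrable on their domain** (bounded Borel integrand on a set of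
finite volume). [cite: KontsevichZagier2001, §1.2] -/
theorem integrableOn (h : TameAdm N ⟨k, σ, f⟩) : IntegrableOn f σ :=
  Measure.integrableOn_of_bounded h.volume_lt_top.ne h.measurable.aestronglyMeasurable
    (M := N) (ae_of_all _ fun z => by rw [Real.norm_eq_abs]; exact h.abs_apply_le' z)

/-- Tame pairs are absolutely integrable on the whole space (they vanish off the domain).
[cite: KontsevichZagier2001, §1.2] -/
theorem integrable (h : TameAdm N ⟨k, σ, f⟩) : Integrable f := by
  rw [← h.indicator_eq, integrable_indicator_iff h.measurableSet]
  exact h.integrableOn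

/-- **Tame pairs are admissible in the raw real calculus** `KZOver.Raw` (real semialgebraic
domain, real semialgebraic integrand on it, absolutely integrable).
[cite: KontsevichZagier2001, §1.2] -/
theorem rawAdm (h : TameAdm N ⟨k, σ, f⟩) : KZOver.Raw.Adm k σ f :=
  ⟨h.isSemialgebraic, h.isSemialgebraicFunOn, h.integrableOn⟩

end TameAdm

/-! ### The four tame move sets -/

/-- **Tame move (1a), additivity in the domain**, over raw real data with all three pairs `N`-tame:
`σ = σ₁ ∪ σ₂`, `σ₁ ∩ σ₂` null, integrands agreeing on the pieces; the move is
`[σ, f] − [σ₁, f₁] − [σ₂, f₂]`. [cite: KontsevichZagier2001, §1.2 rule (1)] -/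
def tameDomainAddMoves (N : ℕ) : Set RawFormal :=
  {c | ∃ (k : ℕ) (σ σ₁ σ₂ : Set (Fin k → ℝ)) (f f₁ f₂ : (Fin k → ℝ) → ℝ),
    TameAdm N ⟨k, σ, f⟩ ∧ TameAdm N ⟨k, σ₁, f₁⟩ ∧ TameAdm N ⟨k, σ₂, f₂⟩ ∧ σ = σ₁ ∪ σ₂ ∧
    MeasureTheory.volume (σ₁ ∩ σ₂) = 0 ∧ Set.EqOn f f₁ σ₁ ∧ Set.EqOn f f₂ σ₂ ∧
    c = rawGen k σ f - rawGen k σ₁ f₁ - rawGen k σ₂ f₂}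

/-- **Tame move (1b), additivity in the integrand**: same tame domain, `f = f₁ + f₂` on it; the
move is `[σ, f] − [σ, f₁] − [σ, f₂]`. [cite: KontsevichZagier2001, §1.2 rule (1)] -/
def tameIntegrandAddMoves (N : ℕ) : Set RawFormal :=
  {c | ∃ (k : ℕ) (σ : Set (Fin k → ℝ)) (f f₁ f₂ : (Fin k → ℝ) → ℝ),
    TameAdm N ⟨k, σ, f⟩ ∧ TameAdm N ⟨k, σ, f₁⟩ ∧ TameAdm N ⟨k, σ, f₂⟩ ∧ Set.EqOn f (f₁ + f₂) σ ∧
    c = rawGen k σ f - rawGen k σ f₁ - rawGen k σ f₂}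

/-- **Tame move (2), change of variables** along `Φ` with the exact side conditions of
`KZ.changeOfVariablesRel` (derivative `Φ' x` within `σ`, injectivity, `σ' = Φ '' σ`,
`f = (f' ∘ Φ) · |det Φ'|` on `σ`), both pairs `N`-tame and the GRAPH of `Φ` over `σ` of complexity
`≤ N` (so `Φ` is real semialgebraic on `σ`, real parameters allowed); the move is
`[σ, f] − [σ', f']`. [cite: KontsevichZagier2001, §1.2 rule (2)] -/
def tameCovMoves (N : ℕ) : Set RawFormal :=
  {c | ∃ (k : ℕ) (σ σ' : Set (Fin k → ℝ)) (f f' : (Fin k → ℝ) → ℝ) (Φ : (Fin k → ℝ) → (Fin k → ℝ))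
      (Φ' : (Fin k → ℝ) → (Fin k → ℝ) →L[ℝ] (Fin k → ℝ)),
    TameAdm N ⟨k, σ, f⟩ ∧ TameAdm N ⟨k, σ', f'⟩ ∧
    TameCplx N (k + k) {w : Fin (k + k) → ℝ | (fun i : Fin k => w (Fin.castAdd k i)) ∈ σ ∧
      (fun i : Fin k => w (Fin.natAdd k i)) = Φ (fun i : Fin k => w (Fin.castAdd k i))} ∧
    (∀ x ∈ σ, HasFDerivWithinAt Φ (Φ' x) σ x) ∧ Set.InjOn Φ σ ∧ σ' = Φ '' σ ∧
    (∀ x ∈ σ, f x = f' (Φ x) * |(Φ' x).det|) ∧ c = rawGen k σ f - rawGen k σ' f'}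

/-- **Tame move (3), Newton–Leibniz along the last coordinate** with the exact side conditions of
`KZ.newtonLeibnizRel` (band `β = {(x, s) | x ∈ τ, a x ≤ s ≤ b x}` over the base `τ`, primitive `F`
continuous on each closed fibre with derivative the band integrand `g` on the open fibre,
`h x = F (x, b x) − F (x, a x)`), the band and base pairs `N`-tame, the graphs of `a`, `b`, `F` of
complexity `≤ N`, and the primitive RENORMALISED: `|F| ≤ N` on the band; the move is
`[β, g] − [τ, h]`. [cite: KontsevichZagier2001, §1.2 rule (3)] -/
def tameNLMoves (N : ℕ) : Set RawFormal :=
  {c | ∃ (k : ℕ) (β : Set (Fin (k + 1) → ℝ)) (g : (Fin (k + 1) → ℝ) → ℝ) (τ : Set (Fin k → ℝ))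
      (h a b : (Fin k → ℝ) → ℝ) (F : (Fin (k + 1) → ℝ) → ℝ),
    TameAdm N ⟨k + 1, β, g⟩ ∧ TameAdm N ⟨k, τ, h⟩ ∧
    TameCplx N (k + 1) {w : Fin (k + 1) → ℝ | Fin.init w ∈ τ ∧ w (Fin.last k) = a (Fin.init w)} ∧
    TameCplx N (k + 1) {w : Fin (k + 1) → ℝ | Fin.init w ∈ τ ∧ w (Fin.last k) = b (Fin.init w)} ∧
    TameCplx N (k + 2) {w : Fin (k + 2) → ℝ | Fin.init w ∈ β ∧ w (Fin.last (k + 1)) = F (Fin.init w)} ∧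
    (∀ z ∈ β, |F z| ≤ N) ∧ (∀ x ∈ τ, a x ≤ b x) ∧
    β = {z : Fin (k + 1) → ℝ | Fin.init z ∈ τ ∧ a (Fin.init z) ≤ z (Fin.last k) ∧
      z (Fin.last k) ≤ b (Fin.init z)} ∧
    (∀ x ∈ τ, ContinuousOn (fun s : ℝ => F (Fin.snoc x s)) (Set.Icc (a x) (b x))) ∧
    (∀ x ∈ τ, ∀ s ∈ Set.Ioo (a x) (b x),
      HasDerivAt (fun s : ℝ => F (Fin.snoc x s)) (g (Fin.snoc x s)) s) ∧
    (∀ x ∈ τ, h x = F (Fin.snoc x (b x)) - F (Fin.snoc x (a x))) ∧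
    c = rawGen (k + 1) β g - rawGen k τ h}

/-- **The tame moves of level `N`**: the union of the four tame move sets. Verbatim the
`let Moves` of item `BoundedCost` (route InequalityCost). [cite: KontsevichZagier2001, §1.2] -/
def tameMoves (N : ℕ) : Set RawFormal :=
  tameDomainAddMoves N ∪ tameIntegrandAddMoves N ∪ tameCovMoves N ∪ tameNLMoves N

section Mono

variable {N N' : ℕ}

/-- Tame domain-additivity moves are monotone in the level. [cite: KontsevichZagier2001, §1.2 rule (1)] -/
theorem tameDomainAddMoves_mono (hN : N ≤ N') : tameDomainAddMoves N ⊆ tameDomainAddMoves N' := by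
  rintro c ⟨k, σ, σ₁, σ₂, f, f₁, f₂, h, h₁, h₂, hrest⟩
  exact ⟨k, σ, σ₁, σ₂, f, f₁, f₂, h.mono hN, h₁.mono hN, h₂.mono hN, hrest⟩

/-- Tame integrand-additivity moves are monotone in the level. [cite: KontsevichZagier2001, §1.2 rule (1)] -/
theorem tameIntegrandAddMoves_mono (hN : N ≤ N') :
    tameIntegrandAddMoves N ⊆ tameIntegrandAddMoves N' := by
  rintro c ⟨k, σ, f, f₁, f₂, h, h₁, h₂, hrest⟩
  exact ⟨k, σ, f, f₁, f₂, h.mono hN, h₁.mono hN, h₂.mono hN, hrest⟩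

/-- Tame change-of-variables moves are monotone in the level. [cite: KontsevichZagier2001, §1.2 rule (2)] -/
theorem tameCovMoves_mono (hN : N ≤ N') : tameCovMoves N ⊆ tameCovMoves N' := by
  rintro c ⟨k, σ, σ', f, f', Φ, Φ', h, h', hΦ, hrest⟩
  exact ⟨k, σ, σ', f, f', Φ, Φ', h.mono hN, h'.mono hN, hΦ.mono hN, hrest⟩

/-- Tame Newton–Leibniz moves are monotone in the level. [cite: KontsevichZagier2001, §1.2 rule (3)] -/
theorem tameNLMoves_mono (hN : N ≤ N') : tameNLMoves N ⊆ tameNLMoves N' := by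
  rintro c ⟨k, β, g, τ, h, a, b, F, hβ, hτ, ha, hb, hF, hFle, hrest⟩
  have hNR : (N : ℝ) ≤ N' := Nat.cast_le.mpr hN
  exact ⟨k, β, g, τ, h, a, b, F, hβ.mono hN, hτ.mono hN, ha.mono hN, hb.mono hN, hF.mono hN,
    fun z hz => (hFle z hz).trans hNR, hrest⟩

/-- The tame moves are monotone in the level. [cite: KontsevichZagier2001, §1.2] -/
theorem tameMoves_mono (hN : N ≤ N') : tameMoves N ⊆ tameMoves N' :=
  union_subset_union (union_subset_union (union_subset_union (tameDomainAddMoves_mono hN)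
    (tameIntegrandAddMoves_mono hN)) (tameCovMoves_mono hN)) (tameNLMoves_mono hN)

end Mono

/-! ### Tame moves are raw real KZ moves -/

section Sound

variable {N : ℕ}

/-- A tame domain-additivity move is a raw domain-additivity move of `KZ_ℝ`.
[cite: KontsevichZagier2001, §1.2 rule (1)] -/
theorem tameDomainAddMoves_subset : tameDomainAddMoves N ⊆ KZOver.Raw.domainAddSet := by
  rintro c ⟨k, σ, σ₁, σ₂, f, f₁, f₂, h, h₁, h₂, hdom, hnull, he₁, he₂, rfl⟩
  exact ⟨k, σ, σ₁, σ₂, f, f₁, f₂, h.rawAdm, h₁.rawAdm, h₂.rawAdm, hdom, hnull, he₁, he₂, rfl⟩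

/-- A tame integrand-additivity move is a raw integrand-additivity move of `KZ_ℝ`.
[cite: KontsevichZagier2001, §1.2 rule (1)] -/
theorem tameIntegrandAddMoves_subset : tameIntegrandAddMoves N ⊆ KZOver.Raw.integrandAddSet := by
  rintro c ⟨k, σ, f, f₁, f₂, h, h₁, h₂, hadd, rfl⟩
  exact ⟨k, σ, f, f₁, f₂, h.rawAdm, h₁.rawAdm, h₂.rawAdm, hadd, rfl⟩

/-- A tame change-of-variables move is a raw change-of-variables move of `KZ_ℝ` (the graph of `Φ`
over `σ` has bounded complexity, so `Φ` is a real semialgebraic map on `σ`).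
[cite: KontsevichZagier2001, §1.2 rule (2)] -/
theorem tameCovMoves_subset : tameCovMoves N ⊆ KZOver.Raw.changeOfVariablesSet := by
  rintro c ⟨k, σ, σ', f, f', Φ, Φ', h, h', hΦ, hΦ', hinj, hdom, hf, rfl⟩
  refine ⟨k, σ, σ', f, f', Φ, Φ', h.rawAdm, h'.rawAdm, ?_, hΦ', hinj, hdom, hf, rfl⟩
  rw [IsSemialgebraicMapOn, setOf_exists_eq_append]
  exact hΦ.isSemialgebraic

/-- A tame Newton–Leibniz move is a raw Newton–Leibniz move of `KZ_ℝ` (the graphs of `a`, `b`, `F`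
have bounded complexity, so these are real semialgebraic functions).
[cite: KontsevichZagier2001, §1.2 rule (3)] -/
theorem tameNLMoves_subset : tameNLMoves N ⊆ KZOver.Raw.newtonLeibnizSet := by
  rintro c ⟨k, β, g, τ, h, a, b, F, hβ, hτ, ha, hb, hF, -, hab, hband, hcont, hderiv, hh, rfl⟩
  exact ⟨k, β, g, τ, h, a, b, F, hβ.rawAdm, hτ.rawAdm, isSemialgebraicFunOn_iff.mpr hF.isSemialgebraic,
    isSemialgebraicFunOn_iff.mpr ha.isSemialgebraic, isSemialgebraicFunOn_iff.mpr hb.isSemialgebraic,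
    hab, hband, hcont, hderiv, hh, rfl⟩

/-- **Every tame move is a relation of the raw real calculus** `KZOver.Raw.Rel`.
[cite: KontsevichZagier2001, §1.2] -/
theorem tameMoves_subset_rawRel : tameMoves N ⊆ (KZOver.Raw.Rel : Set RawFormal) := by
  refine Set.Subset.trans ?_ AddSubgroup.subset_closure
  exact union_subset_union (union_subset_union (union_subset_union tameDomainAddMoves_subset
    tameIntegrandAddMoves_subset) tameCovMoves_subset) tameNLMoves_subset

/-- **Soundness of the tame moves**: a tame move evaluates to `0`. [cite: KontsevichZagier2001, §1.2] -/
theorem rawEval_eq_zero_of_mem_tameMoves {c : RawFormal} (hc : c ∈ tameMoves N) : rawEval c = 0 :=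
  rawEval_eq_zero_of_mem_rawRel (tameMoves_subset_rawRel hc)

end Sound

/-! ### One-sided certificates and the inequality cost -/

/-- **One-sided `ε`-certificate of size `≤ N`** for a formal combination `c` of raw real pairs:
there are an `N`-tame pair `p = (π, g_p)` with `g_p ≥ 0` on `π` and `N` summands
`mᵢ ∈ ±tameMoves N ∪ {0}` with the FORMAL IDENTITY
`c + [([0, ε] ⊆ ℝ¹, 1)] − [p] = Σᵢ mᵢ` in `RawFormal`.
Soundly (`TameCert.neg_le_rawEval`) such a certificate proves `rawEval c ≥ −ε`; for two tame
volume forms, `c = volGen n σA − volGen n σB`, it is an `ε`-inequality proof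
`vol σA − vol σB ≥ −ε` inside the tame rules, the format of Viu-Sos' packing certificates for strict
volume inequalities. With that `c` this is verbatim the `let Cert N n σA σB ε` of item
`BoundedCost` (route InequalityCost). [cite: Viusos2020, §4 (Lemmas 4.1–4.3, Remark 4.1)] -/
def TameCert (N : ℕ) (c : RawFormal) (ε : ℝ) : Prop :=
  ∃ (kp : ℕ) (π : Set (Fin kp → ℝ)) (gp : (Fin kp → ℝ) → ℝ) (m : Fin N → RawFormal),
    TameAdm N ⟨kp, π, gp⟩ ∧ (∀ z ∈ π, 0 ≤ gp z) ∧
    (∀ i, m i ∈ tameMoves N ∨ -m i ∈ tameMoves N ∨ m i = 0) ∧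
    c + volGen 1 (epsInterval ε) - rawGen kp π gp = ∑ i, m i

namespace TameCert

variable {N N' : ℕ} {c : RawFormal} {ε : ℝ}

/-- **Certificates persist at larger size** (pad the summands with zeros; tameness and the move
sets are monotone in the level). [cite: Viusos2020, §4] -/
theorem mono (h : TameCert N c ε) (hN : N ≤ N') : TameCert N' c ε := by
  obtain ⟨d, rfl⟩ := Nat.exists_eq_add_of_le hN
  obtain ⟨kp, π, gp, m, hp, hp0, hm, hsum⟩ := h
  refine ⟨kp, π, gp, Fin.append m (fun _ => 0), hp.mono hN, hp0, fun i => ?_, ?_⟩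
  · induction i using Fin.addCases with
    | left i =>
      rw [Fin.append_left]
      rcases hm i with h | h | h
      · exact Or.inl (tameMoves_mono hN h)
      · exact Or.inr (Or.inl (tameMoves_mono hN h))
      · exact Or.inr (Or.inr h)
    | right j => rw [Fin.append_right]; exact Or.inr (Or.inr rfl)
  · rw [hsum, Fin.sum_univ_add]
    simp

/-- The formal identity of a certificate places `c + [([0, ε], 1)] − [p]` in the raw relation
subgroup `KZOver.Raw.Rel`. [cite: Viusos2020, §4] -/
theorem exists_mem_rawRel (h : TameCert N c ε) :
    ∃ (kp : ℕ) (π : Set (Fin kp → ℝ)) (gp : (Fin kp → ℝ) → ℝ), TameAdm N ⟨kp, π, gp⟩ ∧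
      (∀ z ∈ π, 0 ≤ gp z) ∧ c + volGen 1 (epsInterval ε) - rawGen kp π gp ∈ KZOver.Raw.Rel := by
  obtain ⟨kp, π, gp, m, hp, hp0, hm, hsum⟩ := h
  refine ⟨kp, π, gp, hp, hp0, ?_⟩
  rw [hsum]
  refine AddSubgroup.sum_mem _ fun i _ => ?_
  rcases hm i with h | h | h
  · exact tameMoves_subset_rawRel h
  · have h' := KZOver.Raw.Rel.neg_mem (tameMoves_subset_rawRel h)
    rwa [neg_neg] at h'
  · rw [h]; exact KZOver.Raw.Rel.zero_mem

/-- **Soundness of one-sided certificates**: a size-`N` certificate for `c` at `ε ≥ 0` proves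
`rawEval c ≥ −ε`. Indeed `rawEval` kills every summand (`rawEval_eq_zero_of_mem_tameMoves`),
`rawEval [([0, ε], 1)] = ε` and `rawEval [p] = ∫_π g_p ≥ 0`. [cite: Viusos2020, §4] -/
theorem neg_le_rawEval (h : TameCert N c ε) (hε : 0 ≤ ε) : -ε ≤ rawEval c := by
  obtain ⟨kp, π, gp, m, hp, hp0, hm, hsum⟩ := h
  have hmi : ∀ i, rawEval (m i) = 0 := fun i => by
    rcases hm i with h | h | h
    · exact rawEval_eq_zero_of_mem_tameMoves h
    · have h0 := rawEval_eq_zero_of_mem_tameMoves h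
      rwa [map_neg, neg_eq_zero] at h0
    · rw [h, map_zero]
  have hs := congrArg rawEval hsum
  rw [map_sum, Finset.sum_eq_zero (fun i _ => hmi i), map_sub, map_add,
    rawEval_volGen_epsInterval hε, rawEval_rawGen] at hs
  have hp_nonneg : 0 ≤ ∫ z in π, gp z := setIntegral_nonneg hp.measurableSet fun z hz => hp0 z hz
  linarith

/-- Soundness for two volume forms: a certificate for `volGen n σA − volGen n σB` at `ε ≥ 0`
proves `vol σA − vol σB ≥ −ε` (measurable `σA`, `σB`). [cite: Viusos2020, §4] -/
theorem neg_le_measureReal_sub {n : ℕ} {σA σB : Set (Fin n → ℝ)} (hA : MeasurableSet σA)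
    (hB : MeasurableSet σB) (h : TameCert N (volGen n σA - volGen n σB) ε) (hε : 0 ≤ ε) :
    -ε ≤ volume.real σA - volume.real σB := by
  have := h.neg_le_rawEval hε
  rwa [map_sub, rawEval_volGen hA, rawEval_volGen hB] at this

/-- Soundness for two KZ representations with integrand `1` on their domains (tame volume forms,
the setting of items `BoundedCost` / `TameVolumeKernel`): a certificate for
`volGen n A.domain − volGen n B.domain` at `ε ≥ 0` proves `A.value − B.value ≥ −ε`.
[cite: Viusos2020, §4] -/
theorem neg_le_value_sub {n : ℕ} (A B : IntegralRep n) (hA : EqOn A.integrand 1 A.domain)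
    (hB : EqOn B.integrand 1 B.domain) (h : TameCert N (volGen n A.domain - volGen n B.domain) ε)
    (hε : 0 ≤ ε) : -ε ≤ A.value - B.value := by
  have hvA : A.value = volume.real A.domain := by
    rw [IntegralRep.value, setIntegral_congr_fun (IntegralRep.measurableSet_domain_holds A) hA]
    simp only [Pi.one_apply, setIntegral_const, smul_eq_mul, mul_one]
  have hvB : B.value = volume.real B.domain := by
    rw [IntegralRep.value, setIntegral_congr_fun (IntegralRep.measurableSet_domain_holds B) hB]
    simp only [Pi.one_apply, setIntegral_const, smul_eq_mul, mul_one]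
  rw [hvA, hvB]
  exact h.neg_le_measureReal_sub (IntegralRep.measurableSet_domain_holds A)
    (IntegralRep.measurableSet_domain_holds B) hε

end TameCert

open Classical in
/-- **The inequality cost** of a formal combination `c` at `ε`: the least size `N` of a one-sided
`ε`-certificate `TameCert N c ε`, in `ℕ∞` (`⊤` when no certificate of any size exists). For two
tame volume forms `A`, `B` the route's `N_c(ε)` is `inequalityCost (volGen n A.domain − volGen n
B.domain) ε`, and item `BoundedCost` says it is bounded over `ε ∈ ℚ ∩ (0, 1)`.
[cite: Viusos2020, §4 (Lemmas 4.1–4.3, Remark 4.1)] -/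
def inequalityCost (c : RawFormal) (ε : ℝ) : ℕ∞ :=
  if h : ∃ N : ℕ, TameCert N c ε then (Nat.find h : ℕ∞) else ⊤

section Cost

variable {c : RawFormal} {ε : ℝ} {N : ℕ}

/-- The cost is `⊤` iff there is no certificate of any size. [cite: Viusos2020, §4] -/
theorem inequalityCost_eq_top_iff : inequalityCost c ε = ⊤ ↔ ∀ N : ℕ, ¬ TameCert N c ε := by
  classical
  unfold inequalityCost
  split_ifs with h
  · simp only [ENat.coe_ne_top, false_iff, not_forall, not_not]
    exact h
  · simpa using h

/-- The cost is finite iff some certificate exists. [cite: Viusos2020, §4] -/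
theorem inequalityCost_lt_top_iff : inequalityCost c ε < ⊤ ↔ ∃ N : ℕ, TameCert N c ε := by
  rw [lt_top_iff_ne_top, Ne, inequalityCost_eq_top_iff]
  push Not
  rfl

/-- **Characterisation of the cost**: `inequalityCost c ε ≤ N` iff a size-`N` certificate exists
(certificates persist at larger size, `TameCert.mono`). [cite: Viusos2020, §4] -/
theorem inequalityCost_le_iff : inequalityCost c ε ≤ N ↔ TameCert N c ε := by
  classical
  unfold inequalityCost
  split_ifs with h
  · rw [Nat.cast_le, Nat.find_le_iff]
    exact ⟨fun ⟨m, hm, hc⟩ => hc.mono hm, fun hc => ⟨N, le_rfl, hc⟩⟩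
  · simp only [top_le_iff, ENat.coe_ne_top, false_iff]
    exact fun hc => h ⟨N, hc⟩

/-- A certificate of size `N` bounds the cost by `N`. [cite: Viusos2020, §4] -/
theorem TameCert.inequalityCost_le (h : TameCert N c ε) : inequalityCost c ε ≤ N :=
  inequalityCost_le_iff.mpr h

end Cost

/-! ### Non-vacuity: the trivial identity has bounded cost -/

section NonVacuity

open FirstOrder FirstOrder.Language

/-- The padding pair `([0, ε] ⊆ ℝ¹, 1_{[0, ε]})` is `N`-tame for all `0 ≤ ε ≤ 1` as soon as `N`
exceeds the codes of the two templates `0 ≤ x₀ ∧ x₀ ≤ θ` (domain) and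
`(0 ≤ w₀ ∧ w₀ ≤ θ) ∧ w₁ = 1` (graph), uniformly in the real parameter `θ = ε`.
[cite: Viusos2020, §4] -/
theorem exists_forall_tameAdm_epsInterval :
    ∃ N₀ : ℕ, ∀ N : ℕ, N₀ ≤ N → ∀ ε : ℝ, 0 ≤ ε → ε ≤ 1 →
      TameAdm N ⟨1, epsInterval ε, (epsInterval ε).indicator fun _ => (1 : ℝ)⟩ := by
  -- the two templates: `0 ≤ x₀ ∧ x₀ ≤ θ` (domain) and `(0 ≤ w₀ ∧ w₀ ≤ θ) ∧ w₁ = 1` (graph of `1`)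
  let v : Fin (1 + 1) → Language.orderedRing.Term (Fin (1 + 1) ⊕ Fin 0) := fun i =>
    Term.var (Sum.inl i)
  let φ₁ : Language.orderedRing.Formula (Fin (1 + 1)) :=
    (0 : Language.orderedRing.Term _).le (v 0) ⊓ (v 0).le (v 1)
  let w : Fin (2 + 1) → Language.orderedRing.Term (Fin (2 + 1) ⊕ Fin 0) := fun i =>
    Term.var (Sum.inl i)
  let φ₂ : Language.orderedRing.Formula (Fin (2 + 1)) :=
    ((0 : Language.orderedRing.Term _).le (w 0) ⊓ (w 0).le (w 2)) ⊓ (w 1).bdEqual 1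
  refine ⟨Encodable.encode φ₁ + Encodable.encode φ₂ + 1, fun N hN ε h0 h1 => ?_⟩
  have h1N : (1 : ℝ) ≤ N := by exact_mod_cast (show 1 ≤ N by omega)
  refine ⟨?_, ?_, ?_, ?_, ?_⟩
  · show 1 ≤ N
    omega
  · intro z hz
    change z ∈ epsInterval ε at hz
    refine ⟨fun i => ?_, ?_⟩
    · rw [Subsingleton.elim i 0, abs_of_nonneg hz.1]
      exact hz.2.trans (h1.trans h1N)
    · change |(epsInterval ε).indicator (fun _ => (1 : ℝ)) z| ≤ N
      rw [Set.indicator_of_mem hz, abs_one]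
      exact h1N
  · intro z hz
    change (epsInterval ε).indicator (fun _ => (1 : ℝ)) z = 0
    exact Set.indicator_of_notMem hz _
  · refine ⟨1, φ₁, ![ε], by omega, by omega, ?_⟩
    change epsInterval ε = _
    ext x
    have e0 : Fin.append x ![ε] 0 = x 0 := Fin.append_left x ![ε] 0
    have e1 : Fin.append x ![ε] 1 = ε := Fin.append_right x ![ε] 0
    simp only [mem_epsInterval, mem_setOf_eq, φ₁, v, Formula.Realize, BoundedFormula.realize_inf,
      Term.realize_le, Term.realize_var, Sum.elim_inl, Language.orderedRing.realize_zero, e0, e1]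
  · refine ⟨1, φ₂, ![ε], by omega, by omega, ?_⟩
    change {w : Fin (1 + 1) → ℝ | Fin.init w ∈ epsInterval ε ∧
      w (Fin.last 1) = (epsInterval ε).indicator (fun _ => (1 : ℝ)) (Fin.init w)} = _
    ext x
    have e0 : Fin.append x ![ε] 0 = x 0 := Fin.append_left x ![ε] 0
    have e1 : Fin.append x ![ε] 1 = x 1 := Fin.append_left x ![ε] 1
    have e2 : Fin.append x ![ε] 2 = ε := Fin.append_right x ![ε] 0
    simp only [mem_epsInterval, mem_setOf_eq, φ₂, w, Formula.Realize, BoundedFormula.realize_inf,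
      Term.realize_le, Term.realize_var, Sum.elim_inl, Language.orderedRing.realize_zero,
      Language.orderedRing.realize_one, BoundedFormula.realize_bdEqual, e0, e1, e2]
    have hi0 : Fin.init x 0 = x 0 := rfl
    have hl : x (Fin.last 1) = x 1 := rfl
    rw [hi0, hl]
    constructor
    · rintro ⟨hx, hx1⟩
      rw [Set.indicator_of_mem (show Fin.init x ∈ epsInterval ε from hx)] at hx1
      exact ⟨hx, hx1⟩
    · rintro ⟨hx, hx1⟩
      rw [Set.indicator_of_mem (show Fin.init x ∈ epsInterval ε from hx)]
      exact ⟨hx, hx1⟩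

/-- **Non-vacuity: the trivial identity has cost bounded uniformly in `ε`.** For all
`0 ≤ ε ≤ 1` the formal combination `0` (e.g. `volGen n σ − volGen n σ`, two copies of one volume
form) has a certificate of one fixed size: take `p = ([0, ε], 1)` itself and all summands `0`
(the planner's vacuity check (a) of item `BoundedCost`). [cite: Viusos2020, §4] -/
theorem exists_forall_tameCert_zero :
    ∃ N₀ : ℕ, ∀ N : ℕ, N₀ ≤ N → ∀ ε : ℝ, 0 ≤ ε → ε ≤ 1 → TameCert N 0 ε := by
  obtain ⟨N₀, h⟩ := exists_forall_tameAdm_epsInterval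
  refine ⟨N₀, fun N hN ε h0 h1 => ⟨1, epsInterval ε, (epsInterval ε).indicator fun _ => (1 : ℝ),
    fun _ => 0, h N hN ε h0 h1, fun z hz => ?_, fun _ => Or.inr (Or.inr rfl), ?_⟩⟩
  · rw [Set.indicator_of_mem hz]; exact zero_le_one
  · simp [volGen]

/-- The inequality cost of `c − c` is bounded uniformly over `ε ∈ [0, 1]` (so item `BoundedCost`
holds for `A = B`). [cite: Viusos2020, §4] -/
theorem exists_forall_inequalityCost_sub_self_le (c : RawFormal) :
    ∃ N₀ : ℕ, ∀ ε : ℝ, 0 ≤ ε → ε ≤ 1 → inequalityCost (c - c) ε ≤ N₀ := by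
  obtain ⟨N₀, h⟩ := exists_forall_tameCert_zero
  exact ⟨N₀, fun ε h0 h1 => by rw [sub_self]; exact (h N₀ le_rfl ε h0 h1).inequalityCost_le⟩

end NonVacuity

/-! ### Tame chains extend certificates: tame-equivalent combinations have bounded cost -/

section Chains

variable {N M : ℕ} {c c' : RawFormal} {ε : ℝ}

/-- **Chains extend certificates.** If `c' − c` is a sum of `M` signed tame moves of level `N`
and `c` has a size-`N` certificate at `ε`, then `c'` has a size-`(N + M)` certificate at `ε`
(concatenate the summands; tameness and moves are monotone in the level).
[cite: Viusos2020, §4] -/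
theorem TameCert.of_sub_eq_sum (h : TameCert N c ε) (m' : Fin M → RawFormal)
    (hm' : ∀ j, m' j ∈ tameMoves N ∨ -m' j ∈ tameMoves N ∨ m' j = 0) (hc : c' - c = ∑ j, m' j) :
    TameCert (N + M) c' ε := by
  obtain ⟨kp, π, gp, m, hp, hp0, hm, hsum⟩ := h
  have hN : N ≤ N + M := Nat.le_add_right N M
  refine ⟨kp, π, gp, Fin.append m m', hp.mono hN, hp0, fun i => ?_, ?_⟩
  · induction i using Fin.addCases with
    | left i =>
      rw [Fin.append_left]
      rcases hm i with h | h | h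
      · exact Or.inl (tameMoves_mono hN h)
      · exact Or.inr (Or.inl (tameMoves_mono hN h))
      · exact Or.inr (Or.inr h)
    | right j =>
      rw [Fin.append_right]
      rcases hm' j with h | h | h
      · exact Or.inl (tameMoves_mono hN h)
      · exact Or.inr (Or.inl (tameMoves_mono hN h))
      · exact Or.inr (Or.inr h)
  · rw [Fin.sum_univ_add]
    simp only [Fin.append_left, Fin.append_right, ← hsum, ← hc]
    abel

/-- An element of the subgroup generated by the tame moves of level `N` is a finite sum of signed
tame moves of level `N`. [cite: KontsevichZagier2001, §1.2] -/
theorem exists_sum_of_mem_closure_tameMoves (hc : c ∈ AddSubgroup.closure (tameMoves N)) :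
    ∃ (M : ℕ) (m : Fin M → RawFormal),
      (∀ j, m j ∈ tameMoves N ∨ -m j ∈ tameMoves N ∨ m j = 0) ∧ c = ∑ j, m j := by
  refine AddSubgroup.closure_induction (fun x hx => ?_) ?_ (fun x y _ _ hx hy => ?_)
    (fun x _ hx => ?_) hc
  · exact ⟨1, fun _ => x, fun _ => Or.inl hx, by simp⟩
  · exact ⟨0, fun _ => 0, fun _ => Or.inr (Or.inr rfl), by simp⟩
  · obtain ⟨Mx, mx, hmx, rfl⟩ := hx
    obtain ⟨My, my, hmy, rfl⟩ := hy
    refine ⟨Mx + My, Fin.append mx my, fun i => ?_, ?_⟩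
    · induction i using Fin.addCases with
      | left i => rw [Fin.append_left]; exact hmx i
      | right j => rw [Fin.append_right]; exact hmy j
    · rw [Fin.sum_univ_add]
      simp only [Fin.append_left, Fin.append_right]
  · obtain ⟨M, m, hm, rfl⟩ := hx
    refine ⟨M, fun j => -m j, fun j => ?_, by simp only [Finset.sum_neg_distrib]⟩
    show -m j ∈ tameMoves N ∨ -(-m j) ∈ tameMoves N ∨ -m j = 0
    rcases hm j with h | h | h
    · exact Or.inr (Or.inl (by rwa [neg_neg]))
    · exact Or.inl h
    · exact Or.inr (Or.inr (by rw [h, neg_zero]))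

/-- **Tame-equivalent combinations have bounded cost** (route D2: "cost bounded for tame-equivalent
pairs"): if `c` lies in the subgroup generated by the tame moves of some level `N` — e.g.
`c = volGen n σA − volGen n σB` for two volume forms joined by a tame chain — then ONE size `N'`
certifies `c` at every `ε ∈ [0, 1]`. [cite: Viusos2020, §4] -/
theorem exists_forall_tameCert_of_mem_closure (hc : c ∈ AddSubgroup.closure (tameMoves N)) :
    ∃ N' : ℕ, ∀ ε : ℝ, 0 ≤ ε → ε ≤ 1 → TameCert N' c ε := by
  obtain ⟨M, m, hm, hsum⟩ := exists_sum_of_mem_closure_tameMoves hc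
  obtain ⟨N₀, h0⟩ := exists_forall_tameCert_zero
  refine ⟨max N₀ N + M, fun ε hε0 hε1 => ?_⟩
  refine (h0 (max N₀ N) (le_max_left _ _) ε hε0 hε1).of_sub_eq_sum m (fun j => ?_) ?_
  · rcases hm j with h | h | h
    · exact Or.inl (tameMoves_mono (le_max_right _ _) h)
    · exact Or.inr (Or.inl (tameMoves_mono (le_max_right _ _) h))
    · exact Or.inr (Or.inr h)
  · rw [sub_zero, hsum]

/-- The inequality cost of a tame-equivalent combination is bounded uniformly over `ε ∈ [0, 1]`.
[cite: Viusos2020, §4] -/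
theorem exists_forall_inequalityCost_le_of_mem_closure
    (hc : c ∈ AddSubgroup.closure (tameMoves N)) :
    ∃ N' : ℕ, ∀ ε : ℝ, 0 ≤ ε → ε ≤ 1 → inequalityCost c ε ≤ N' := by
  obtain ⟨N', h⟩ := exists_forall_tameCert_of_mem_closure hc
  exact ⟨N', fun ε h0 h1 => (h ε h0 h1).inequalityCost_le⟩

end Chains

end KZ

end Literature.NumberTheory.Transcendental
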